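import Mathlib
import Literature.AlgebraicGeometry.Resolution.NearPointForcedChart
import Literature.AlgebraicGeometry.Resolution.NearPointDirectrixGraph
import Literature.AlgebraicGeometry.Resolution.RsopAdaptedShift
import HarnessLib

/-!
# One step along a chain of `τ = 2` near points: the STEP data

Topic: `Literature/AlgebraicGeometry/Resolution`. Geometry of one step `x ↦ x′` of an infinite
chain of near points with `τ(x) = τ(x′) = 2` in the termination proof of Cossart–Piltant 2008,
Prop. 4.4 (p. 11; Lemma 4.3 (3) and (12)): for the blowing up `π` of the regular
three-dimensional `X` at the closed point `x = π x′`, `x′` near with `τ(x′) = τ(x) = 2`, and an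
ADAPTED regular system of parameters `c` at `x` (index `j`, `RsopAdaptedShift.IsAdapted`), we
produce the data consumed by the ring-level recursion `AdaptedChainRecursion`
(`IsBlowup.exists_stepData_of_adapted`): the transformed parameters `c′` of `𝒪_{X′,x′}`
(`c′_j = π^*c_j`, `π^*c_i = π^*c_j · c′_i`, `NearPointForcedChart`), the weak-transform
containment `((J_x)𝒪_{x′} : (c′_j)^μ) ⊆ J′_{x′}` for the controlled transform `J′`, and the
residues `λ_i` with `T_{x′} = <Y_i′ + λ_i Y_j′>` (`NearPointDirectrixGraph`) for which every shift
`c′_i ↦ c′_i − a_i c′_j`, `ā_i = −λ_i`, is adapted (`RsopAdaptedShift`). Also the residue map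
`𝒪_{X,x} → k(x′)` is onto (`NearPointsPointCentre`).

## Sources

* V. Cossart, O. Piltant, J. Algebra 320 (2008), Lemma 4.3 (3), (12), proof of Prop. 4.4 p. 11. [CossartPiltant2008]
* H. Hironaka, *Desingularization of excellent surfaces* (Bowdoin 1967), LNM 1101, Thm. 2. [Hironaka1970]
-/

noncomputable section

open CategoryTheory CategoryTheory.Limits AlgebraicGeometry TopologicalSpace IsLocalRing MvPolynomial

namespace Literature.AlgebraicGeometry.Resolution

universe u

open Scheme.IdealSheafData

variable {X X' : Scheme.{u}} {π : X' ⟶ X}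

set_option maxHeartbeats 800000 in
/-- **STEP data at a `τ = 2 → τ = 2` near point over adapted coordinates.** See the module
docstring. [cite: CossartPiltant2008, Lemma 4.3 (3), (12); proof of Prop. 4.4 p. 11] -/
theorem IsBlowup.exists_stepData_of_adapted [IsLocallyNoetherian X] [IsLocallyNoetherian X']
    {Y : Closeds X} (hπ : IsBlowup π (vanishingIdeal Y)) {J : X.IdealSheafData} {μ : ℕ} (hμ : 1 ≤ μ)
    {x' : X'} [IsRegularLocalRing (X.presheaf.stalk (π x'))] [IsRegularLocalRing (X'.presheaf.stalk x')]
    (hd : (maximalIdeal (X.presheaf.stalk (π x'))).spanFinrank = 3)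
    {c : Fin 3 → X.presheaf.stalk (π x')} (hc : Ideal.span (Set.range c) = maximalIdeal _)
    (hcY : Ideal.span (Set.range c) = stalkIdeal (vanishingIdeal Y) (π x'))
    (hτ : stalkTau J (π x') μ = 2) (hnear : IsNear π (vanishingIdeal Y) J μ x')
    (hτ' : stalkTau (controlledTransform π (vanishingIdeal Y) J μ) x' μ = 2) (j : Fin 3)
    (had : IsAdapted c (stalkIdeal J (π x')) μ j) :
    ∃ (c' : Fin 3 → X'.presheaf.stalk x')
      (lam : {i : Fin 3 // i ≠ j} → ResidueField (X'.presheaf.stalk x')),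
      Ideal.span (Set.range c') = maximalIdeal _ ∧
      (maximalIdeal (X'.presheaf.stalk x')).spanFinrank = 3 ∧
      c' j = (π.stalkMap x').hom (c j) ∧
      (∀ i, i ≠ j → (π.stalkMap x').hom (c i) = (π.stalkMap x').hom (c j) * c' i) ∧
      (∀ g : X'.presheaf.stalk x',
        (π.stalkMap x').hom (c j) ^ μ * g ∈ (stalkIdeal J (π x')).map (π.stalkMap x').hom →
          g ∈ stalkIdeal (controlledTransform π (vanishingIdeal Y) J μ) x') ∧
      (∀ a : {i : Fin 3 // i ≠ j} → X'.presheaf.stalk x', (∀ i, residue _ (a i) = lam i) →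
        IsAdapted (shiftRsop c' j a) (stalkIdeal (controlledTransform π (vanishingIdeal Y) J μ) x') μ j) := by
  classical
  haveI := isDomain_of_isRegularLocalRing (X'.presheaf.stalk x')
  -- the forced chart presentation at the origin, w.r.t. `c` itself
  obtain ⟨𝔴, χ, hloc, hχ, h𝔴, he, hd', hspan', hself, hrel⟩ :=
    exists_adapted_transform hπ hd hc hcY hτ hnear j (fun ℓ hℓ => had.apply_single_eq_zero hℓ)
  letI := χ.toAlgebra
  haveI : IsLocalization.AtPrime (X'.presheaf.stalk x') 𝔴.asIdeal := hloc
  have halg : ∀ b, (algebraMap (chartRing c j) (X'.presheaf.stalk x') :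
      chartRing c j →+* X'.presheaf.stalk x') b = χ b := fun b => rfl
  have hu := stalkMap_apply_eq_mul_chartGen j χ hχ
  -- residue fields: `θ : k(x) ≅ k(x′)`
  obtain ⟨θ, hθdef⟩ : ∃ θ : ResidueField (X.presheaf.stalk (π x')) →+* ResidueField (X'.presheaf.stalk x'),
      θ = ResidueField.map (π.stalkMap x').hom := ⟨_, rfl⟩
  have hθ : ∀ r, θ (residue _ r) = residue _ ((algebraMap (chartRing c j) (X'.presheaf.stalk x') :
      chartRing c j →+* (X'.presheaf.stalk x')) (chartBase c j r)) := by
    intro r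
    rw [hθdef, ResidueField.map_residue, halg, hχ]
  -- `(C 𝒪_{x′}) = (c′_j)` and the stalk of the controlled transform as a colon ideal
  have hCmap : (stalkIdeal (vanishingIdeal Y) (π x')).map (π.stalkMap x').hom =
      Ideal.span {χ (chartBase c j (c j))} := by
    rw [← hcY, Ideal.map_span_range_eq_span_singleton _ c j _ hu, ← hχ]
  have hI'colon : (stalkIdeal (controlledTransform π (vanishingIdeal Y) J μ) x') = Submodule.colon ((stalkIdeal J (π x')).map (π.stalkMap x').hom)
      ((Ideal.span {χ (chartBase c j (c j))} ^ μ : Ideal (X'.presheaf.stalk x')) : Set (X'.presheaf.stalk x')) := by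
    rw [controlledTransform, stalkIdeal_colon, stalkIdeal_pow, stalkIdeal_comap_eq_map_stalkMap,
      stalkIdeal_comap_eq_map_stalkMap, hCmap]
  -- the weak transforms of the forms of `J` lie in `J′`
  have hJ' : ∀ F : MvPolynomial (Fin 3) (X.presheaf.stalk (π x')), F.IsHomogeneous μ →
      MvPolynomial.eval c F ∈ (stalkIdeal J (π x')) →
      (algebraMap (chartRing c j) (X'.presheaf.stalk x') : chartRing c j →+* (X'.presheaf.stalk x'))
        (MvPolynomial.eval₂Hom (chartBase c j) (fun i => chartGen c j i) F) ∈ (stalkIdeal (controlledTransform π (vanishingIdeal Y) J μ) x') := by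
    intro F hF hFJ
    rw [halg, hI'colon]
    exact map_mem_colon_of_eq_pow_mul (chartBase c j) χ (π.stalkMap x').hom hχ
      (reesChartBase_eval_eq_pow_mul_eval₂ c j hF) hFJ
  have hnear' : (stalkIdeal (controlledTransform π (vanishingIdeal Y) J μ) x') ≤ maximalIdeal (X'.presheaf.stalk x') ^ μ := (le_idealOrder_iff _ x' μ).mp (isNear_iff.mp hnear).ge
  -- all initial forms w.r.t. `c` avoid `Y_j` (Hironaka's theorem at the origin)
  have h𝔴' : (maximalIdeal _).map (chartBase c j) ≤ 𝔴.asIdeal := by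
    rw [← h𝔴]; exact Ideal.map_comap_le
  have hnearF : ∀ F : MvPolynomial (Fin 3) (X.presheaf.stalk (π x')), F.IsHomogeneous μ →
      MvPolynomial.eval c F ∈ (stalkIdeal J (π x')) →
      (algebraMap (chartRing c j) (Localization.AtPrime 𝔴.asIdeal) :
          chartRing c j →+* Localization.AtPrime 𝔴.asIdeal)
          (MvPolynomial.eval₂Hom (chartBase c j) (fun i => chartGen c j i) F) ∈
        maximalIdeal (Localization.AtPrime 𝔴.asIdeal) ^ μ :=
    fun F hF hFJ => algebraMap_eval₂Hom_mem_pow_of_isNear hcY j 𝔴 χ hχ hloc hnear hF hFJ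
  obtain ⟨ρ, -, -, hρF, h𝔮, -, hS⟩ :=
    exists_chartResidueMap_forall_initialForms_near hd c hc j 𝔴.asIdeal h𝔴' hnearF
  haveI := h𝔮
  have hq : 𝔴.asIdeal.map ρ = Ideal.span (Set.range (MvPolynomial.X : {i : Fin 3 // i ≠ j} →
      MvPolynomial {i : Fin 3 // i ≠ j} (ResidueField (X.presheaf.stalk (π x'))))) := by
    refine ((isMaximal_span_range_X_origin (k := ResidueField (X.presheaf.stalk (π x'))) j).eq_of_le
      (Ideal.IsPrime.ne_top h𝔮) ?_).symm
    rw [Ideal.span_le]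
    rintro _ ⟨i, rfl⟩
    rw [SetLike.mem_coe, ← map_chartGen_of_chartResidueMap c j hρF i.2]
    exact Ideal.mem_map_of_mem _ (he i.1 i.2)
  have hdir := directrix_le_dualVanishingAt j (𝔴.asIdeal.map ρ) hS
  rw [hq] at hdir
  have hall : ∀ G ∈ initialForms c (stalkIdeal J (π x')) μ, ∀ m ∈ G.support, m j = 0 :=
    fun G hG m hm => forall_apply_eq_zero_of_subset_linearFormsSubalgebra j
      (fun ℓ hℓ => apply_single_eq_zero_of_mem_dualVanishingAt_origin j (hdir hℓ))
      (subset_linearFormsSubalgebra_directrix (ResidueField (X.presheaf.stalk (π x')))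
        (initialForms c (stalkIdeal J (π x')) μ : Set (MvPolynomial (Fin 3) (ResidueField (X.presheaf.stalk (π x'))))))
      hG hm
  -- `τ(x) = τ(x′) = 2` in coordinates, and the graph lemma
  have hτc : hironakaTauAt c (stalkIdeal J (π x')) μ + 1 = 3 := by
    rw [← stalkTau_eq J (π x') μ hd c hc, hτ]
  have hτc' : hironakaTauAt (originFamily c j (X'.presheaf.stalk x')) (stalkIdeal (controlledTransform π (vanishingIdeal Y) J μ) x') μ + 1 = 3 := by
    rw [← stalkTau_eq _ x' μ hd' (originFamily c j (X'.presheaf.stalk x')) hspan', hτ']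
  obtain ⟨lam, hgraph⟩ := exists_directrix_eq_span_graph hd c hc j 𝔴.asIdeal h𝔴 he (X'.presheaf.stalk x') θ hθ hμ hJ'
    hnear' hall hτc hτc'
  -- the STEP data
  refine ⟨(originFamily c j (X'.presheaf.stalk x')), fun i => -lam i, hspan', hd', hself, hrel, ?_, ?_⟩
  · -- weak transforms: `(J𝒪_{x′} : c′_j^μ) ⊆ J′`
    intro g hg
    rw [hI'colon, Submodule.mem_colon]
    intro p hp
    rw [hχ, Ideal.span_singleton_pow, SetLike.mem_coe, Ideal.mem_span_singleton'] at hp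
    obtain ⟨r, rfl⟩ := hp
    rw [smul_eq_mul, show g * (r * (π.stalkMap x').hom (c j) ^ μ) =
      r * ((π.stalkMap x').hom (c j) ^ μ * g) by ring]
    exact Ideal.mul_mem_left _ _ hg
  · -- re-adaptation by shifts with residues `−λ`
    intro a ha
    refine isAdapted_shiftRsop hd' hspan' j a ?_
    -- the vector `(1, ā) = (1, −λ)` is killed by `T_{x′} = <Y_i + λ_i Y_j>`
    have hW : invarianceSpace (ResidueField (X'.presheaf.stalk x'))
        (initialForms (originFamily c j (X'.presheaf.stalk x')) (stalkIdeal (controlledTransform π (vanishingIdeal Y) J μ) x') μ : Set (MvPolynomial (Fin 3) (ResidueField (X'.presheaf.stalk x')))) =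
        (directrix (ResidueField (X'.presheaf.stalk x'))
          (initialForms (originFamily c j (X'.presheaf.stalk x')) (stalkIdeal (controlledTransform π (vanishingIdeal Y) J μ) x') μ : Set (MvPolynomial (Fin 3) (ResidueField (X'.presheaf.stalk x'))))).dualCoannihilator :=
      (Subspace.dualAnnihilator_dualCoannihilator_eq).symm
    rw [hW, Submodule.mem_dualCoannihilator, hgraph]
    intro ℓ hℓ
    refine Submodule.span_induction ?_ (by simp) (fun _ _ _ _ h1 h2 => by rw [LinearMap.add_apply, h1, h2, add_zero])
      (fun t _ _ h1 => by rw [LinearMap.smul_apply, h1, smul_zero]) hℓ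
    rintro _ ⟨i, rfl⟩
    simp only [LinearMap.add_apply, LinearMap.smul_apply, LinearMap.coe_proj, Function.eval,
      dif_neg i.2, ha i, smul_eq_mul]
    simp

/-- **The residue field of a `τ = 2` near point over a point centre is reached from `𝒪_{X,x}`.**
(Restatement of `IsBlowup.residue_comp_stalkMap_surjective_of_isNear_point`.)
[cite: CossartPiltant2008, Lemma 4.3 (3)] -/
theorem IsBlowup.residue_comp_stalkMap_surjective_of_isNear_point' [IsLocallyNoetherian X]
    [IsLocallyNoetherian X'] {Y : Closeds X} (hπ : IsBlowup π (vanishingIdeal Y))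
    {J : X.IdealSheafData} {μ : ℕ} {x' : X'} [IsRegularLocalRing (X.presheaf.stalk (π x'))]
    (hd : (maximalIdeal (X.presheaf.stalk (π x'))).spanFinrank = 3)
    (hcY : maximalIdeal _ = stalkIdeal (vanishingIdeal Y) (π x'))
    (hτ : stalkTau J (π x') μ = 2) (hnear : IsNear π (vanishingIdeal Y) J μ x') :
    Function.Surjective ((IsLocalRing.residue (X'.presheaf.stalk x')).comp (π.stalkMap x').hom) := by
  obtain ⟨c, hc⟩ : ∃ c : Fin 3 → X.presheaf.stalk (π x'), Ideal.span (Set.range c) = maximalIdeal _ := by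
    obtain ⟨c, hc⟩ := exists_regularSystemOfParameters (R := X.presheaf.stalk (π x'))
    refine ⟨c ∘ finCongr hd.symm, ?_⟩
    rw [(finCongr hd.symm).surjective.range_comp]
    exact hc
  exact hπ.residue_comp_stalkMap_surjective_of_isNear_point hd hc (hc.trans hcY) hτ hnear

/-- The composite `𝒪_{X,πx′} → 𝒪_{X′,x′} ≅ 𝒪_{X′,q}` for a point `q = x′` (bookkeeping for chains,
where the near point of one step is the image point of the next). [folklore] -/
def stalkMapCongr (π : X' ⟶ X) (x' q : X') (h : q = x') :
    X.presheaf.stalk (π x') →+* X'.presheaf.stalk q :=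
  (X'.presheaf.stalkCongr (Inseparable.of_eq h)).inv.hom.comp (π.stalkMap x').hom

/-- With `q = x′` literally, `stalkMapCongr` is the stalk map. [folklore] -/
theorem stalkMapCongr_self (π : X' ⟶ X) (x' : X') :
    stalkMapCongr π x' x' rfl = (π.stalkMap x').hom := by
  ext a
  simp [stalkMapCongr]

set_option maxHeartbeats 800000 in
/-- `IsBlowup.exists_stepData_of_adapted` transported to a point `q = x′`.
[cite: CossartPiltant2008, Lemma 4.3 (3), (12); proof of Prop. 4.4 p. 11] -/
theorem IsBlowup.exists_stepData_of_adapted_congr [IsLocallyNoetherian X] [IsLocallyNoetherian X']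
    {Y : Closeds X} (hπ : IsBlowup π (vanishingIdeal Y)) {J : X.IdealSheafData} {μ : ℕ} (hμ : 1 ≤ μ)
    {x' : X'} [IsRegularLocalRing (X.presheaf.stalk (π x'))] [IsRegularLocalRing (X'.presheaf.stalk x')]
    (hd : (maximalIdeal (X.presheaf.stalk (π x'))).spanFinrank = 3)
    {c : Fin 3 → X.presheaf.stalk (π x')} (hc : Ideal.span (Set.range c) = maximalIdeal _)
    (hcY : Ideal.span (Set.range c) = stalkIdeal (vanishingIdeal Y) (π x'))
    (hτ : stalkTau J (π x') μ = 2) (hnear : IsNear π (vanishingIdeal Y) J μ x')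
    (hτ' : stalkTau (controlledTransform π (vanishingIdeal Y) J μ) x' μ = 2) (j : Fin 3)
    (had : IsAdapted c (stalkIdeal J (π x')) μ j) (q : X') (h : q = x') :
    ∃ (_ : IsRegularLocalRing (X'.presheaf.stalk q)) (c' : Fin 3 → X'.presheaf.stalk q)
      (lam : {i : Fin 3 // i ≠ j} → ResidueField (X'.presheaf.stalk q)),
      Ideal.span (Set.range c') = maximalIdeal _ ∧
      (maximalIdeal (X'.presheaf.stalk q)).spanFinrank = 3 ∧
      c' j = stalkMapCongr π x' q h (c j) ∧
      (∀ i, i ≠ j → stalkMapCongr π x' q h (c i) = stalkMapCongr π x' q h (c j) * c' i) ∧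
      (∀ g : X'.presheaf.stalk q,
        stalkMapCongr π x' q h (c j) ^ μ * g ∈ (stalkIdeal J (π x')).map (stalkMapCongr π x' q h) →
          g ∈ stalkIdeal (controlledTransform π (vanishingIdeal Y) J μ) q) ∧
      (∀ a : {i : Fin 3 // i ≠ j} → X'.presheaf.stalk q, (∀ i, residue _ (a i) = lam i) →
        IsAdapted (shiftRsop c' j a) (stalkIdeal (controlledTransform π (vanishingIdeal Y) J μ) q) μ j) ∧
      Function.Surjective ((IsLocalRing.residue (X'.presheaf.stalk q)).comp (stalkMapCongr π x' q h)) := by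
  subst h
  obtain ⟨c', lam, h1, h2, h3, h4, h5, h6⟩ :=
    hπ.exists_stepData_of_adapted hμ hd hc hcY hτ hnear hτ' j had
  refine ⟨inferInstance, c', lam, h1, h2, ?_, ?_, ?_, h6, ?_⟩
  · rw [stalkMapCongr_self]; exact h3
  · simpa only [stalkMapCongr_self] using h4
  · simpa only [stalkMapCongr_self] using h5
  · rw [stalkMapCongr_self]
    exact hπ.residue_comp_stalkMap_surjective_of_isNear_point hd hc hcY hτ hnear

/-- Residue surjectivity transported to a point `q = x′`. [cite: CossartPiltant2008, Lemma 4.3 (3)] -/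
theorem IsBlowup.residue_comp_stalkMapCongr_surjective [IsLocallyNoetherian X]
    [IsLocallyNoetherian X'] {Y : Closeds X} (hπ : IsBlowup π (vanishingIdeal Y))
    {J : X.IdealSheafData} {μ : ℕ} {x' : X'} [IsRegularLocalRing (X.presheaf.stalk (π x'))]
    (hd : (maximalIdeal (X.presheaf.stalk (π x'))).spanFinrank = 3)
    (hcY : maximalIdeal _ = stalkIdeal (vanishingIdeal Y) (π x'))
    (hτ : stalkTau J (π x') μ = 2) (hnear : IsNear π (vanishingIdeal Y) J μ x') (q : X') (h : q = x') :
    Function.Surjective ((IsLocalRing.residue (X'.presheaf.stalk q)).comp (stalkMapCongr π x' q h)) := by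
  subst h
  rw [stalkMapCongr_self]
  exact hπ.residue_comp_stalkMap_surjective_of_isNear_point' hd hcY hτ hnear

/-- `stalkMapCongr` is a local homomorphism. [folklore] -/
instance isLocalHom_stalkMapCongr (π : X' ⟶ X) (x' q : X') (h : q = x') :
    IsLocalHom (stalkMapCongr π x' q h) := by
  subst h
  rw [stalkMapCongr_self]
  infer_instance

end Literature.AlgebraicGeometry.Resolution

end
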